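import Literature.Computability.QuantumComplexity.SymExecCodeFP
import Literature.Computability.QuantumComplexity.BravyiGossetEstimator
import HarnessLib
/-!
# The Bravyi–Gosset estimator on codes, III: the data of one term and one term step

Topic `Literature/Computability/QuantumComplexity`, sub-namespace `BravyiGosset`, machine side of
the discharge of `BravyiGosset2016_estimateAcceptProb` (continued from `SymExecCodeFP.lean`).
The Gauss data `buildData N h β a σ` of the `a`-th term of a sample against the test state `β`
(`BravyiGossetPairData.lean`) are assembled by four left folds (`augR` twice nested, `augRho`,
`augA`); here each fold is restarted from SANITISED data (`GData.sanitize`, the identity on sized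
data), which makes the folds polynomially bounded for every input of the string function and
equal to the original ones on the shaped states that actually occur (`buildDataS_eq`). With the
evaluator of `GaussCodeFP.lean` this gives one `termStep` of the estimator on codes
(`termStepS_codeFP`, `termStepS_eq`), on the integer pairs `ℤ × ℤ` standing for Gaussian integers.

## References

* S. Arora, B. Barak, *Computational Complexity: A Modern Approach*, CUP 2009, §1.3.
* S. Bravyi, D. Gosset, *Improved classical simulation of quantum circuits dominated by Clifford
  gates*, Phys. Rev. Lett. 116 (2016) 250501, §II eq. (12)–(13), (17).
-/

namespace Literature.Computability.QuantumComplexity.BravyiGosset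

open _root_.Computability Literature.Computability.Complexity Literature.Computability.Complexity.CodeFP
  Literature.Computability.Cryptography

/-! ### Sanitised folds -/

namespace SymState

/-- The inner `R`-loop (over `j < j'`), restarted from sanitised data. [folklore] -/
def augRinS (K N : ℕ) (β : ℕ → Bool) (σ : SymState) (j' : ℕ) (D : GData) : GData :=
  (List.range j').foldl
    (fun D j => if β (idxR N j j') then GData.addQuadProduct (σ.form j) (σ.form j') D else D) (GData.sanitize K D)

/-- The outer `R`-loop, restarted from sanitised data (the inner bound is cut at `N`). [folklore] -/
def augRS (K N : ℕ) (β : ℕ → Bool) (σ : SymState) (D : GData) : GData :=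
  (List.range N).foldl (fun D j' => augRinS K N β σ (min N j') D) (GData.sanitize K D)

/-- The `ρ`-loop, restarted from sanitised data. [folklore] -/
def augRhoS (K N : ℕ) (β : ℕ → Bool) (σ : SymState) (D : GData) : GData :=
  (List.range N).foldl (fun D j => GData.addPhaseForm (kapAt N β j) (σ.form j) D) (GData.sanitize K D)

/-- One pair factor with the pair index cut at `K` and the bit `a_p` read off the binary digits of
the term number `A`. [cite: BravyiGosset2016, eq. (17)] -/
def pairStepS (K h : ℕ) (σ : SymState) (A : ℕ) (D : GData) (p : ℕ) : GData :=
  pairStep h σ (fun p => Nat.testBit A (min K p)) D (min K p)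

/-- The pair loop, restarted from sanitised data. [cite: BravyiGosset2016, eq. (17)] -/
def augAS (K h : ℕ) (σ : SymState) (A : ℕ) (D : GData) : GData :=
  (List.range (numA σ)).foldl (pairStepS K h σ A) (GData.sanitize K D)

/-- **The Gauss data of term `A` against the block `β`, with sanitised folds.**
[cite: BravyiGosset2016, §II eq. (12)–(13) and eq. (17)] -/
def buildDataS (K N h : ℕ) (β : ℕ → Bool) (A : ℕ) (σ : SymState) : GData :=
  augAS K h σ A (augOut h σ (augRhoS K N β σ (augRS K N β σ σ.D)))

/-! ### Shapes along the folds -/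

variable {K B N h : ℕ} {β : ℕ → Bool} {σ : SymState}

/-- The inner `R`-loop keeps sized data. [folklore] -/
theorem sized_foldl_R (hF : ∀ j, (σ.form j).a.length ≤ B) (j' : ℕ) (l : List ℕ) {D : GData} (hD : D.Sized B) :
    (l.foldl (fun D j => if β (idxR N j j') then GData.addQuadProduct (σ.form j) (σ.form j') D else D) D).Sized B := by
  induction l generalizing D with
  | nil => exact hD
  | cons j l ih =>
    rw [List.foldl_cons]
    apply ih
    split
    · exact hD.addQuadProduct (hF j) (hF j')
    · exact hD

/-- `augRinS` yields sized data. [folklore] -/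
theorem sized_augRinS (hF : ∀ j, (σ.form j).a.length ≤ B) (hK : K ≤ B) (j' : ℕ) (D : GData) :
    (augRinS K N β σ j' D).Sized B :=
  sized_foldl_R hF j' _ ((GData.sized_sanitize K D).mono hK)

/-- The outer `R`-loop keeps sized data. [folklore] -/
theorem sized_foldl_augRinS (hF : ∀ j, (σ.form j).a.length ≤ B) (hK : K ≤ B) (l : List ℕ) {D : GData}
    (hD : D.Sized B) : (l.foldl (fun D j' => augRinS K N β σ (min N j') D) D).Sized B := by
  induction l generalizing D with
  | nil => exact hD
  | cons j l ih => rw [List.foldl_cons]; exact ih (sized_augRinS hF hK _ _)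

/-- The `ρ`-loop keeps sized data. [folklore] -/
theorem sized_foldl_rho (hF : ∀ j, (σ.form j).a.length ≤ B) (l : List ℕ) {D : GData} (hD : D.Sized B) :
    (l.foldl (fun D j => GData.addPhaseForm (kapAt N β j) (σ.form j) D) D).Sized B := by
  induction l generalizing D with
  | nil => exact hD
  | cons j l ih => rw [List.foldl_cons]; exact ih (hD.addPhaseForm _ (hF j))

/-- `augOut` keeps sized data. [folklore] -/
theorem sized_augOut (hF : ∀ j, (σ.form j).a.length ≤ B) (hh : h + 1 ≤ B) {D : GData} (hD : D.Sized B) :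
    (augOut h σ D).Sized B := by
  unfold augOut
  refine hD.addQuadProduct (by simp [AffForm.unit]; omega) ?_
  show (σ.form 0).a.length ≤ B
  exact hF 0

/-- One pair step keeps sized data. [folklore] -/
theorem sized_pairStep (hT : ∀ k, (σ.tform k).a.length ≤ B) (a : ℕ → Bool) {p : ℕ} (hp : h + 2 + p ≤ B)
    {D : GData} (hD : D.Sized B) : (pairStep h σ a D p).Sized B := by
  unfold pairStep
  have hu : (AffForm.unit (h + 1 + p)).a.length ≤ B := by simp [AffForm.unit]; omega
  have hs : (((σ.tform (2 * p)).add (σ.tform (2 * p + 1))).addConst (a p)).a.length ≤ B := by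
    show (AffForm.bxor (σ.tform (2 * p)).a (σ.tform (2 * p + 1)).a).length ≤ B
    rw [AffForm.length_bxor]; exact max_le (hT _) (hT _)
  simp only
  split
  · exact hD.addQuadProduct hu hs
  · exact (hD.addQuadProduct hu hs).addPhaseForm 1 (hT _)

/-- The pair loop with cut indices keeps sized data. [folklore] -/
theorem sized_foldl_pairStepS (hT : ∀ k, (σ.tform k).a.length ≤ B) (A : ℕ) (hB : h + 2 + K ≤ B) (l : List ℕ)
    {D : GData} (hD : D.Sized B) : (l.foldl (pairStepS K h σ A) D).Sized B := by
  induction l generalizing D with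
  | nil => exact hD
  | cons p l ih =>
    rw [List.foldl_cons]
    exact ih (sized_pairStep hT _ (by have := min_le_left K p; omega) hD)

/-! ### The sanitised folds are the original ones on shaped states -/

/-- `augRS = augR` on sized data with short forms. [folklore] -/
theorem augRS_eq (hF : ∀ j, (σ.form j).a.length ≤ K) {D : GData} (hD : D.Sized K) :
    augRS K N β σ D = augR N β σ D := by
  unfold augRS augR
  rw [GData.sanitize_eq_self hD]
  suffices key : ∀ l : List ℕ, (∀ j' ∈ l, j' < N) → ∀ D : GData, D.Sized K →
      l.foldl (fun D j' => augRinS K N β σ (min N j') D) D =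
        l.foldl (fun D j' => (List.range j').foldl
          (fun D j => if β (idxR N j j') then GData.addQuadProduct (σ.form j) (σ.form j') D else D) D) D from
    key _ (fun j' hj' => List.mem_range.1 hj') D hD
  intro l hl
  induction l with
  | nil => intro D _; rfl
  | cons j' l ih =>
    intro D hD
    rw [List.foldl_cons, List.foldl_cons]
    have hj' : min N j' = j' := min_eq_right (hl j' (by simp)).le
    have e : augRinS K N β σ (min N j') D = (List.range j').foldl
        (fun D j => if β (idxR N j j') then GData.addQuadProduct (σ.form j) (σ.form j') D else D) D := by
      rw [hj', augRinS, GData.sanitize_eq_self hD]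
    rw [e]
    exact ih (fun x hx => hl x (by simp [hx])) _ (sized_foldl_R hF j' _ hD)

/-- `augRhoS = augRho` on sized data. [folklore] -/
theorem augRhoS_eq {D : GData} (hD : D.Sized K) : augRhoS K N β σ D = augRho N β σ D := by
  unfold augRhoS augRho; rw [GData.sanitize_eq_self hD]

/-- `augAS = augA` with the bits of `A`, on sized data, when `⌈t/2⌉ ≤ K`. [folklore] -/
theorem augAS_eq (hA : numA σ ≤ K) (A : ℕ) {D : GData} (hD : D.Sized K) :
    augAS K h σ A D = augA h σ (Nat.testBit A) D := by
  unfold augAS augA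
  rw [GData.sanitize_eq_self hD]
  suffices key : ∀ l : List ℕ, (∀ p ∈ l, p < numA σ) → ∀ D : GData,
      l.foldl (pairStepS K h σ A) D = l.foldl (pairStep h σ (Nat.testBit A)) D from
    key _ (fun p hp => List.mem_range.1 hp) D
  intro l hl
  induction l with
  | nil => intro D; rfl
  | cons p l ih =>
    intro D
    rw [List.foldl_cons, List.foldl_cons]
    have hp : min K p = p := min_eq_right (by have := hl p (by simp); omega)
    have e : pairStepS K h σ A D p = pairStep h σ (Nat.testBit A) D p := by
      unfold pairStepS pairStep; simp only [hp]
    rw [e]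
    exact ih (fun x hx => hl x (by simp [hx])) _

/-- **`buildDataS = buildData`, and the data are sized**, on a state whose forms have at most `h`
coefficients and whose phase data are sized by `h`, for `K = h + ⌈t/2⌉ + 1` (`numV`).
[cite: BravyiGosset2016, §II eq. (12)–(13)] -/
theorem buildDataS_eq (hF : ∀ j, (σ.form j).a.length ≤ h) (hT : ∀ k, (σ.tform k).a.length ≤ h)
    (hD : σ.D.Sized h) (β : ℕ → Bool) (A : ℕ) :
    buildDataS (numV h σ) N h β A σ = buildData N h β (Nat.testBit A) σ ∧
      (buildDataS (numV h σ) N h β A σ).Sized (numV h σ) := by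
  set K := numV h σ with hK
  have hKdef : K = h + (numA σ + 1) := rfl
  have hF' : ∀ j, (σ.form j).a.length ≤ K := fun j => (hF j).trans (by omega)
  have hT' : ∀ k, (σ.tform k).a.length ≤ K := fun k => (hT k).trans (by omega)
  have hD' : σ.D.Sized K := hD.mono (by omega)
  -- the four stages, sized by `K`
  have s1 : (augRS K N β σ σ.D).Sized K := by
    unfold augRS; exact sized_foldl_augRinS hF' le_rfl _ ((GData.sized_sanitize K _).mono le_rfl)
  have s2 : (augRhoS K N β σ (augRS K N β σ σ.D)).Sized K := by
    unfold augRhoS; exact sized_foldl_rho hF' _ ((GData.sized_sanitize K _).mono le_rfl)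
  have s3 : (augOut h σ (augRhoS K N β σ (augRS K N β σ σ.D))).Sized K := sized_augOut hF' (by omega) s2
  have e1 := augRS_eq (N := N) (β := β) hF' hD'
  have e2 := augRhoS_eq (N := N) (β := β) (σ := σ) s1
  have e3 := augAS_eq (h := h) (σ := σ) (K := K) (by omega) A s3
  constructor
  · unfold buildDataS buildData augTheta
    rw [e3, e2, e1]
  · unfold buildDataS augAS
    have hB : h + 2 + K ≤ 2 * K + 1 := by omega
    -- sized by `K`: the pair loop only uses indices `p < numA`, so `h + 2 + p ≤ K`
    rw [GData.sanitize_eq_self s3]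
    suffices key : ∀ l : List ℕ, (∀ p ∈ l, p < numA σ) → ∀ D : GData, D.Sized K →
        (l.foldl (pairStepS K h σ A) D).Sized K from key _ (fun p hp => List.mem_range.1 hp) _ s3
    intro l hl
    induction l with
    | nil => intro D hD; exact hD
    | cons p l ih =>
      intro D hD
      rw [List.foldl_cons]
      refine ih (fun x hx => hl x (by simp [hx])) _ ?_
      unfold pairStepS
      exact sized_pairStep hT' _ (by have := hl p (by simp); have := min_le_right K p; omega) hD

end SymState

/-! ### One term on integer pairs -/

/-- The number of `1`s among the first `n` digits of `A`, digits cut at `K` (a left fold).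
[folklore] -/
def popNS (K n A : ℕ) : ℕ :=
  (List.range n).foldl (fun acc p => acc + Bool.toNat (Nat.testBit A (min K p))) 0

/-- `popNS = popN` when `n ≤ K`. [folklore] -/
theorem popNS_eq {K n : ℕ} (hn : n ≤ K) (A : ℕ) : popNS K n A = popN n A := by
  unfold popNS popN
  suffices key : ∀ m, m ≤ n → ∀ acc, (List.range m).foldl (fun acc p => acc + Bool.toNat (Nat.testBit A (min K p))) acc =
      acc + ∑ p ∈ Finset.range m, Bool.toNat (Nat.testBit A p) by
    have := key n le_rfl 0; rwa [Nat.zero_add] at this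
  intro m hm
  induction m with
  | zero => intro acc; simp
  | succ m ih =>
    intro acc
    rw [List.range_succ, List.foldl_append, ih (by omega), List.foldl_cons, List.foldl_nil,
      Finset.sum_range_succ, min_eq_right (by omega), Nat.add_assoc]

/-- A bound on the cut digit count. [folklore] -/
theorem popNS_le (K n A : ℕ) : popNS K n A ≤ n := by
  unfold popNS
  suffices key : ∀ (l : List ℕ) (acc : ℕ),
      l.foldl (fun acc p => acc + Bool.toNat (Nat.testBit A (min K p))) acc ≤ acc + l.length by
    simpa using key (List.range n) 0
  intro l
  induction l with
  | nil => intro acc; simp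
  | cons p l ih =>
    intro acc
    rw [List.foldl_cons, List.length_cons]
    refine (ih _).trans ?_
    have : Bool.toNat (Nat.testBit A (min K p)) ≤ 1 := Bool.toNat_le _
    omega

/-- **One term step on integer pairs** (sanitised folds, digits cut at `K = numV`): add
`i^{⌊m/2⌋} Γ` to the even or odd accumulator according to the parity of `m = |A|`.
[cite: BravyiGosset2016, §II eq. (12)–(13)] -/
def termStepS (N : ℕ) (β : ℕ → Bool) (σ : SymState) (EO : (ℤ × ℤ) × (ℤ × ℤ)) (A : ℕ) : (ℤ × ℤ) × (ℤ × ℤ) :=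
  let K := SymState.numV σ.nv σ
  let m := popNS K (SymState.numA σ) A
  let c := zgMul (iPowZg (m / 2)) (zgOf (GData.gaussEval K (GData.sanitize K (SymState.buildDataS K N σ.nv β A σ))))
  if m % 2 = 0 then (zgAdd EO.1 c, EO.2) else (EO.1, zgAdd EO.2 c)

/-- **`termStepS` is `termStep`** on the pairs of the accumulators, for a shaped state.
[cite: BravyiGosset2016, §II eq. (12)–(13)] -/
theorem termStepS_eq {N' G N : ℕ} {σ : SymState} (hσ : σ.Shaped N' G) (β : ℕ → Bool)
    (EO : GaussianInt × GaussianInt) (A : ℕ) :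
    termStepS N β σ (zgOf EO.1, zgOf EO.2) A =
      (zgOf (termStep N σ.nv β σ EO A).1, zgOf (termStep N σ.nv β σ EO A).2) := by
  obtain ⟨_, h2, h3, h4, _, _⟩ := hσ
  have hF : ∀ j, (σ.form j).a.length ≤ σ.nv := SymState.length_form_le h2
  have hT : ∀ k, (σ.tform k).a.length ≤ σ.nv := by
    intro k
    unfold SymState.tform
    rw [List.getD_eq_getElem?_getD]
    cases hk : σ.tforms[k]? with
    | none => simp [AffForm.const]
    | some f => simpa using h3 f (List.mem_of_getElem? hk)
  obtain ⟨e1, s1⟩ := SymState.buildDataS_eq (N := N) hF hT h4 β A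
  have hA : SymState.numA σ ≤ SymState.numV σ.nv σ := by unfold SymState.numV; omega
  unfold termStepS termStep
  simp only
  rw [popNS_eq hA, GData.sanitize_eq_self s1, e1, iPowZg_eq, ← zgOf_mul]
  by_cases hm : popN (SymState.numA σ) A % 2 = 0
  · simp [hm, zgOf_add]
  · simp [hm, zgOf_add]

/-! ### Codes: contexts and small arithmetic -/

/-- The context of a sample: the symbolic state, the number of wires (unary), the block of coins.
[folklore] -/
abbrev TCtx : Type := SymState × ℕ × List Bool

/-- The code of a sample context. [folklore] -/
abbrev tcE : TCtx → List Bool := pairE stE (pairE unE bitsE)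

/-- `numA` on codes (unary). [folklore] -/
theorem numA_codeFP : CodeFP stE unE SymState.numA := by
  have ht : CodeFP stE unE (fun σ => σ.tforms.length + 1) := by
    exact (unSucc.comp ((ulength affE).comp stT) :)
  have hd : CodeFP stE natE (fun σ => (σ.tforms.length + 1) / 2) := by
    exact (natDiv.comp ((natOfUn.comp ht).pair (const _ 2)) :)
  exact (unOfNatMin.comp (ht.pair hd)).congr fun σ => by
    show min ((σ.tforms.length + 1) / 2) (σ.tforms.length + 1) = _
    rw [min_eq_left (Nat.div_le_self _ _)]; rfl

/-- `numV nv` on codes (unary). [folklore] -/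
theorem numV_codeFP : CodeFP stE unE (fun σ => SymState.numV σ.nv σ) :=
  (unAdd.comp (stNv.pair (unSucc.comp numA_codeFP))).congr fun _ => rfl

/-- Reading a coin of the block (`0` beyond it). [folklore] -/
theorem betaAt : CodeFP (pairE bitsE natE) bitE (fun t => t.1.getD t.2 false) :=
  (rawGetOr bitE).comp ((fst bitsE natE).pair ((snd bitsE natE).pair (const _ false)))

/-- `Bool.toNat` on codes. [folklore] -/
theorem toNat_codeFP : CodeFP bitE natE Bool.toNat :=
  ((CodeFP.id bitE).ite (const _ (1 : ℕ)) (const _ (0 : ℕ))).congr fun b => by cases b <;> rfl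

/-- A binary digit with the position cut at a unary budget: `(1ᴷ, A, p) ↦ bit_{min K p}(A)`.
[folklore] -/
theorem testBitMin : CodeFP (pairE unE (pairE natE natE)) bitE (fun t => Nat.testBit t.2.1 (min t.1 t.2.2)) := by
  have hK : CodeFP (pairE unE (pairE natE natE)) unE (fun t => t.1) := fst _ _
  have hA : CodeFP (pairE unE (pairE natE natE)) natE (fun t => t.2.1) := (snd _ _).fst'
  have hp : CodeFP (pairE unE (pairE natE natE)) natE (fun t => t.2.2) := (snd _ _).snd'
  have hpu : CodeFP (pairE unE (pairE natE natE)) unE (fun t => min t.2.2 t.1) := by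
    exact (unOfNatMin.comp (hK.pair hp) :)
  have hpow : CodeFP (pairE unE (pairE natE natE)) natE (fun t => 2 ^ min t.2.2 t.1) := by
    exact (natPow.comp ((const _ 2).pair hpu) :)
  have hq : CodeFP (pairE unE (pairE natE natE)) natE (fun t => t.2.1 / 2 ^ min t.2.2 t.1 % 2) := by
    exact (natMod.comp ((natDiv.comp (hA.pair hpow)).pair (const _ 2)) :)
  exact ((natEq.comp (hq.pair (const _ 1))).congr fun t => by
    simp only
    rw [min_comm, Nat.testBit_eq_decide_div_mod_eq])

/-- Sanitising on codes: `(1ᴷ, D) ↦ sanitize K D`. [folklore] -/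
theorem sanitize_codeFP : CodeFP (pairE unE gdE) gdE (fun t => GData.sanitize t.1 t.2) := by
  have hK : CodeFP (pairE unE gdE) unE (fun t => t.1) := fst unE gdE
  have hD : CodeFP (pairE unE gdE) gdE (fun t => t.2) := snd unE gdE
  have hmu : CodeFP (pairE unE gdE) natE (fun t => t.2.mu % 4) := by
    exact (natMod.comp ((gdMu.comp hD).pair (const _ 4)) :)
  have hmod : CodeFP natE natE (fun x => x % 4) := by
    exact (natMod.comp ((CodeFP.id natE).pair (const _ 4)) :)
  have hlam : CodeFP (pairE unE gdE) natsE (fun t => (t.2.lam.take t.1).map (· % 4)) := by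
    exact ((map₀ hmod).comp ((rawTakeUn natE).comp (hK.pair (gdLam.comp hD))) :)
  have hrow : CodeFP (pairE unE bitsE) bitsE (fun q => q.2.take q.1) := rawTakeUn bitE
  have hB : CodeFP (pairE unE gdE) rowsE (fun t => (t.2.B.take t.1).map fun row => row.take t.1) := by
    exact ((map hrow).comp (hK.pair ((rawTakeUn bitsE).comp (hK.pair (gdB.comp hD)))) :)
  exact (gdMk.comp (hmu.pair (hlam.pair hB))).congr fun t => rfl

/-! ### Codes: the folds -/

section Folds

/-- A read form is not longer than the state code. [folklore] -/
theorem length_form_le_stE (σ : SymState) (j : ℕ) : (σ.form j).a.length ≤ (stE σ).length := by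
  unfold SymState.form
  rw [List.getD_eq_getElem?_getD]
  cases hj : σ.forms[j]? with
  | none => simp [AffForm.const]
  | some f =>
    simp only [Option.getD_some]
    have h1 : f.a.length ≤ (affE f).length := by
      refine (length_le_length_rawE bitE f.a).trans ?_
      show (rawE bitE f.a).length ≤ (boolPair (bitE f.c) (rawE bitE f.a)).length
      rw [length_boolPair]; omega
    have h2 := length_item_le_length_rawE affE (List.mem_of_getElem? hj)
    have h3 : (rawE affE σ.forms).length ≤ (stE σ).length := by
      show (rawE affE σ.forms).length ≤
        (boolPair (rawE affE σ.forms) (boolPair (gdE σ.D) (boolPair (rawE affE σ.tforms) (unE σ.nv)))).length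
      rw [length_boolPair]; omega
    omega

/-- A read `T` form is not longer than the state code. [folklore] -/
theorem length_tform_le_stE (σ : SymState) (k : ℕ) : (σ.tform k).a.length ≤ (stE σ).length := by
  unfold SymState.tform
  rw [List.getD_eq_getElem?_getD]
  cases hk : σ.tforms[k]? with
  | none => simp [AffForm.const]
  | some f =>
    simp only [Option.getD_some]
    have h1 : f.a.length ≤ (affE f).length := by
      refine (length_le_length_rawE bitE f.a).trans ?_
      show (rawE bitE f.a).length ≤ (boolPair (bitE f.c) (rawE bitE f.a)).length
      rw [length_boolPair]; omega
    have h2 := length_item_le_length_rawE affE (List.mem_of_getElem? hk)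
    have h3 : (rawE affE σ.tforms).length ≤ (stE σ).length := by
      show (rawE affE σ.tforms).length ≤
        (boolPair (rawE affE σ.forms) (boolPair (gdE σ.D) (boolPair (rawE affE σ.tforms) (unE σ.nv)))).length
      rw [length_boolPair, length_boolPair, length_boolPair]; omega
    omega

/-- `numV nv σ ≤ |stE σ| + 1`. [folklore] -/
theorem numV_le_stE (σ : SymState) : SymState.numV σ.nv σ ≤ (stE σ).length + 1 := by
  unfold SymState.numV SymState.numA
  have h1 := length_le_length_rawE affE σ.tforms
  have h2 : (rawE affE σ.tforms).length + (unE σ.nv).length ≤ (stE σ).length := by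
    show (rawE affE σ.tforms).length + (unE σ.nv).length ≤
      (boolPair (rawE affE σ.forms) (boolPair (gdE σ.D) (boolPair (rawE affE σ.tforms) (unE σ.nv)))).length
    rw [length_boolPair, length_boolPair, length_boolPair]; omega
  rw [length_unE] at h2
  omega

/-- Evaluating the size polynomial. [folklore] -/
theorem eval_sizePoly (X : ℕ) : (8 * Polynomial.X ^ 2 + 18 * Polynomial.X + 10 : Polynomial ℕ).eval X = 8 * X ^ 2 + 18 * X + 10 := by
  simp [Polynomial.eval_add, Polynomial.eval_mul, Polynomial.eval_pow]

/-- The context of the inner `R`-loop: sample context, `j'`, data. [folklore] -/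
abbrev icE : TCtx × ℕ × GData → List Bool := pairE tcE (pairE natE gdE)

/-- **The inner `R`-loop on codes.** [cite: AroraBarakCC2009, §1.3] -/
theorem augRinS_codeFP : CodeFP icE gdE
    (fun s => SymState.augRinS (SymState.numV s.1.1.nv s.1.1) s.1.2.1 (fun p => s.1.2.2.getD p false) s.1.1
      (min s.1.2.1 s.2.1) s.2.2) := by
  -- the step, in context `(s, (j, D))`
  have hs : CodeFP (pairE icE (pairE natE gdE)) icE (fun t => t.1) := fst _ _
  have hj : CodeFP (pairE icE (pairE natE gdE)) natE (fun t => t.2.1) := (snd _ _).fst'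
  have hD : CodeFP (pairE icE (pairE natE gdE)) gdE (fun t => t.2.2) := (snd _ _).snd'
  have hσ : CodeFP (pairE icE (pairE natE gdE)) stE (fun t => t.1.1.1) := by
    exact ((fst _ _).comp ((fst _ _).comp hs) :)
  have hN : CodeFP (pairE icE (pairE natE gdE)) unE (fun t => t.1.1.2.1) := by
    exact ((snd _ _).fst'.comp ((fst _ _).comp hs) :)
  have hbl : CodeFP (pairE icE (pairE natE gdE)) bitsE (fun t => t.1.1.2.2) := by
    exact ((snd _ _).snd'.comp ((fst _ _).comp hs) :)
  have hj' : CodeFP (pairE icE (pairE natE gdE)) natE (fun t => min t.1.1.2.1 t.1.2.1) := by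
    exact (natMin.comp ((natOfUn.comp hN).pair ((snd _ _).fst'.comp hs)) :)
  have hidx : CodeFP (pairE icE (pairE natE gdE)) natE (fun t => min t.1.1.2.1 t.1.2.1 * t.1.1.2.1 + t.2.1) := by
    exact (natAdd.comp ((natMul.comp (hj'.pair (natOfUn.comp hN))).pair hj) :)
  have hb : CodeFP (pairE icE (pairE natE gdE)) bitE
      (fun t => t.1.1.2.2.getD (min t.1.1.2.1 t.1.2.1 * t.1.1.2.1 + t.2.1) false) := by
    exact (betaAt.comp (hbl.pair hidx) :)
  have hfj : CodeFP (pairE icE (pairE natE gdE)) affE (fun t => t.1.1.1.form t.2.1) := by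
    exact (formAt.comp (hσ.pair hj) :)
  have hfj' : CodeFP (pairE icE (pairE natE gdE)) affE (fun t => t.1.1.1.form (min t.1.1.2.1 t.1.2.1)) := by
    exact (formAt.comp (hσ.pair hj') :)
  have haqp : CodeFP (pairE icE (pairE natE gdE)) gdE
      (fun t => GData.addQuadProduct (t.1.1.1.form t.2.1) (t.1.1.1.form (min t.1.1.2.1 t.1.2.1)) t.2.2) := by
    exact (addQuadProduct_codeFP.comp (hfj.pair (hfj'.pair hD)) :)
  have hstep : CodeFP (pairE icE (pairE natE gdE)) gdE (fun t =>
      if t.1.1.2.2.getD (idxR t.1.1.2.1 t.2.1 (min t.1.1.2.1 t.1.2.1)) false then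
        GData.addQuadProduct (t.1.1.1.form t.2.1) (t.1.1.1.form (min t.1.1.2.1 t.1.2.1)) t.2.2 else t.2.2) :=
    (hb.ite haqp hD).congr fun t => by unfold idxR; rfl
  -- the initial value and the list
  have hK : CodeFP icE unE (fun s => SymState.numV s.1.1.nv s.1.1) := by
    exact (numV_codeFP.comp ((fst _ _).comp (fst _ _)) :)
  have hinit : CodeFP icE gdE (fun s => GData.sanitize (SymState.numV s.1.1.nv s.1.1) s.2.2) := by
    exact (sanitize_codeFP.comp (hK.pair ((snd _ _).snd')) :)
  have hlist : CodeFP icE (rawE natE) (fun s => List.range (min s.1.2.1 s.2.1)) := by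
    exact ((rangeOf.comp (((snd _ _).fst'.comp (fst _ _)).pair ((snd _ _).fst'))).congr fun s => by simp only; rw [min_comm] :)
  have h := foldl (σ := TCtx × ℕ × GData) (α := ℕ) (β := GData) (eσ := icE) (eα := natE) (eβ := gdE)
    (step := fun s j D => if s.1.2.2.getD (idxR s.1.2.1 j (min s.1.2.1 s.2.1)) false then
        GData.addQuadProduct (s.1.1.form j) (s.1.1.form (min s.1.2.1 s.2.1)) D else D)
    (init := fun s => GData.sanitize (SymState.numV s.1.1.nv s.1.1) s.2.2) hstep hinit
    (8 * Polynomial.X ^ 2 + 18 * Polynomial.X + 10) (fun s l₁ l₂ => ?_)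
  · refine ((h.comp ((CodeFP.id icE).pair hlist)).congr fun s => ?_)
    unfold SymState.augRinS; rfl
  · rw [eval_sizePoly]
    set X := (pairE icE (rawE natE) (s, l₁ ++ l₂)).length with hX
    have hσX : (stE s.1.1).length + 1 ≤ X := by
      rw [hX]
      show _ ≤ (boolPair (boolPair (boolPair (stE s.1.1) (boolPair (unE s.1.2.1) (bitsE s.1.2.2)))
        (boolPair (natE s.2.1) (gdE s.2.2))) (rawE natE (l₁ ++ l₂))).length
      rw [length_boolPair, length_boolPair, length_boolPair]; omega
    have hF : ∀ j, (s.1.1.form j).a.length ≤ X := fun j => (length_form_le_stE _ j).trans (by omega)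
    have hKX : SymState.numV s.1.1.nv s.1.1 ≤ X := (numV_le_stE _).trans hσX
    have hsz := SymState.sized_foldl_R (N := s.1.2.1) (β := fun p => s.1.2.2.getD p false) hF (min s.1.2.1 s.2.1) l₁
      ((GData.sized_sanitize (SymState.numV s.1.1.nv s.1.1) s.2.2).mono hKX)
    exact GData.length_gdE_le hsz

end Folds

/-- **The outer `R`-loop on codes**, from the context `(σ, 1ᴺ, block)` on `σ.D`.
[cite: AroraBarakCC2009, §1.3] -/
theorem augRS_codeFP : CodeFP tcE gdE
    (fun s => SymState.augRS (SymState.numV s.1.nv s.1) s.2.1 (fun p => s.2.2.getD p false) s.1 s.1.D) := by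
  have hstep : CodeFP (pairE tcE (pairE natE gdE)) gdE (fun t =>
      SymState.augRinS (SymState.numV t.1.1.nv t.1.1) t.1.2.1 (fun p => t.1.2.2.getD p false) t.1.1
        (min t.1.2.1 t.2.1) t.2.2) := by
    exact (augRinS_codeFP.comp ((fst _ _).pair (((snd _ _).fst').pair ((snd _ _).snd'))) :)
  have hK : CodeFP tcE unE (fun s => SymState.numV s.1.nv s.1) := by
    exact (numV_codeFP.comp (fst _ _) :)
  have hinit : CodeFP tcE gdE (fun s => GData.sanitize (SymState.numV s.1.nv s.1) s.1.D) := by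
    exact (sanitize_codeFP.comp (hK.pair (stD.comp (fst _ _))) :)
  have hlist : CodeFP tcE (rawE natE) (fun s => List.range s.2.1) := by
    exact (urange.comp ((snd _ _).fst') :)
  have h := foldl (σ := TCtx) (α := ℕ) (β := GData) (eσ := tcE) (eα := natE) (eβ := gdE)
    (step := fun s j' D => SymState.augRinS (SymState.numV s.1.nv s.1) s.2.1 (fun p => s.2.2.getD p false) s.1
        (min s.2.1 j') D)
    (init := fun s => GData.sanitize (SymState.numV s.1.nv s.1) s.1.D) hstep hinit
    (8 * Polynomial.X ^ 2 + 18 * Polynomial.X + 10) (fun s l₁ l₂ => ?_)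
  · exact ((h.comp ((CodeFP.id tcE).pair hlist)).congr fun s => rfl)
  · rw [eval_sizePoly]
    set X := (pairE tcE (rawE natE) (s, l₁ ++ l₂)).length with hX
    have hσX : (stE s.1).length + 1 ≤ X := by
      rw [hX]
      show _ ≤ (boolPair (boolPair (stE s.1) (boolPair (unE s.2.1) (bitsE s.2.2))) (rawE natE (l₁ ++ l₂))).length
      rw [length_boolPair, length_boolPair]; omega
    have hF : ∀ j, (s.1.form j).a.length ≤ X := fun j => (length_form_le_stE _ j).trans (by omega)
    have hKX : SymState.numV s.1.nv s.1 ≤ X := (numV_le_stE _).trans hσX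
    exact GData.length_gdE_le (SymState.sized_foldl_augRinS hF hKX l₁
      ((GData.sized_sanitize (SymState.numV s.1.nv s.1) s.1.D).mono hKX))

/-- `κ_j = −ρ_j mod 4` read off the block, on codes: `(block, (1ᴺ, j)) ↦ kapAt N β j`. [folklore] -/
theorem kapAt_codeFP : CodeFP (pairE bitsE (pairE unE natE)) natE (fun t => kapAt t.2.1 (fun p => t.1.getD p false) t.2.2) := by
  have hbl : CodeFP (pairE bitsE (pairE unE natE)) bitsE (fun t => t.1) := fst _ _
  have hN : CodeFP (pairE bitsE (pairE unE natE)) natE (fun t => t.2.1) := by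
    exact (natOfUn.comp (snd _ _).fst' :)
  have hj : CodeFP (pairE bitsE (pairE unE natE)) natE (fun t => t.2.2) := (snd _ _).snd'
  have h0 : CodeFP (pairE bitsE (pairE unE natE)) natE (fun t => t.2.1 * t.2.1 + 2 * t.2.2) := by
    exact (natAdd.comp ((natMul.comp (hN.pair hN)).pair (natMul.comp ((const _ 2).pair hj))) :)
  have h1 : CodeFP (pairE bitsE (pairE unE natE)) natE (fun t => t.2.1 * t.2.1 + 2 * t.2.2 + 1) := by
    exact (natAdd.comp (h0.pair (const _ 1)) :)
  have hb0 : CodeFP (pairE bitsE (pairE unE natE)) natE (fun t => Bool.toNat (t.1.getD (t.2.1 * t.2.1 + 2 * t.2.2) false)) := by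
    exact (toNat_codeFP.comp (betaAt.comp (hbl.pair h0)) :)
  have hb1 : CodeFP (pairE bitsE (pairE unE natE)) natE (fun t => Bool.toNat (t.1.getD (t.2.1 * t.2.1 + 2 * t.2.2 + 1) false)) := by
    exact (toNat_codeFP.comp (betaAt.comp (hbl.pair h1)) :)
  have hrho : CodeFP (pairE bitsE (pairE unE natE)) natE (fun t =>
      Bool.toNat (t.1.getD (t.2.1 * t.2.1 + 2 * t.2.2) false) + 2 * Bool.toNat (t.1.getD (t.2.1 * t.2.1 + 2 * t.2.2 + 1) false)) := by
    exact (natAdd.comp (hb0.pair (natMul.comp ((const _ 2).pair hb1))) :)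
  exact ((natMod.comp ((natSub.comp ((const _ 4).pair hrho)).pair (const _ 4))).congr fun t => by
    unfold kapAt rhoAt idxRho0 idxRho1; rfl)

/-- **The `ρ`-loop on codes**, from the context `((σ, 1ᴺ, block), D)`. [cite: AroraBarakCC2009, §1.3] -/
theorem augRhoS_codeFP : CodeFP (pairE tcE gdE) gdE
    (fun s => SymState.augRhoS (SymState.numV s.1.1.nv s.1.1) s.1.2.1 (fun p => s.1.2.2.getD p false) s.1.1 s.2) := by
  have hs : CodeFP (pairE (pairE tcE gdE) (pairE natE gdE)) (pairE tcE gdE) (fun t => t.1) := fst _ _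
  have hσ : CodeFP (pairE (pairE tcE gdE) (pairE natE gdE)) stE (fun t => t.1.1.1) := by
    exact ((fst _ _).comp ((fst _ _).comp hs) :)
  have hN : CodeFP (pairE (pairE tcE gdE) (pairE natE gdE)) unE (fun t => t.1.1.2.1) := by
    exact ((snd _ _).fst'.comp ((fst _ _).comp hs) :)
  have hbl : CodeFP (pairE (pairE tcE gdE) (pairE natE gdE)) bitsE (fun t => t.1.1.2.2) := by
    exact ((snd _ _).snd'.comp ((fst _ _).comp hs) :)
  have hj : CodeFP (pairE (pairE tcE gdE) (pairE natE gdE)) natE (fun t => t.2.1) := (snd _ _).fst'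
  have hD : CodeFP (pairE (pairE tcE gdE) (pairE natE gdE)) gdE (fun t => t.2.2) := (snd _ _).snd'
  have hk : CodeFP (pairE (pairE tcE gdE) (pairE natE gdE)) natE (fun t => kapAt t.1.1.2.1 (fun p => t.1.1.2.2.getD p false) t.2.1) := by
    exact (kapAt_codeFP.comp (hbl.pair (hN.pair hj)) :)
  have hstep : CodeFP (pairE (pairE tcE gdE) (pairE natE gdE)) gdE (fun t =>
      GData.addPhaseForm (kapAt t.1.1.2.1 (fun p => t.1.1.2.2.getD p false) t.2.1) (t.1.1.1.form t.2.1) t.2.2) := by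
    exact (addPhaseForm_codeFP.comp (hk.pair ((formAt.comp (hσ.pair hj)).pair hD)) :)
  have hK : CodeFP (pairE tcE gdE) unE (fun s => SymState.numV s.1.1.nv s.1.1) := by
    exact (numV_codeFP.comp ((fst _ _).comp (fst _ _)) :)
  have hinit : CodeFP (pairE tcE gdE) gdE (fun s => GData.sanitize (SymState.numV s.1.1.nv s.1.1) s.2) := by
    exact (sanitize_codeFP.comp (hK.pair (snd _ _)) :)
  have hlist : CodeFP (pairE tcE gdE) (rawE natE) (fun s => List.range s.1.2.1) := by
    exact (urange.comp ((snd _ _).fst'.comp (fst _ _)) :)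
  have h := foldl (σ := TCtx × GData) (α := ℕ) (β := GData) (eσ := pairE tcE gdE) (eα := natE) (eβ := gdE)
    (step := fun s j D => GData.addPhaseForm (kapAt s.1.2.1 (fun p => s.1.2.2.getD p false) j) (s.1.1.form j) D)
    (init := fun s => GData.sanitize (SymState.numV s.1.1.nv s.1.1) s.2) hstep hinit
    (8 * Polynomial.X ^ 2 + 18 * Polynomial.X + 10) (fun s l₁ l₂ => ?_)
  · exact ((h.comp ((CodeFP.id _).pair hlist)).congr fun s => rfl)
  · rw [eval_sizePoly]
    set X := (pairE (pairE tcE gdE) (rawE natE) (s, l₁ ++ l₂)).length with hX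
    have hσX : (stE s.1.1).length + 1 ≤ X := by
      rw [hX]
      show _ ≤ (boolPair (boolPair (boolPair (stE s.1.1) (boolPair (unE s.1.2.1) (bitsE s.1.2.2))) (gdE s.2))
        (rawE natE (l₁ ++ l₂))).length
      rw [length_boolPair, length_boolPair, length_boolPair]; omega
    have hF : ∀ j, (s.1.1.form j).a.length ≤ X := fun j => (length_form_le_stE _ j).trans (by omega)
    have hKX : SymState.numV s.1.1.nv s.1.1 ≤ X := (numV_le_stE _).trans hσX
    exact GData.length_gdE_le (SymState.sized_foldl_rho hF l₁
      ((GData.sized_sanitize (SymState.numV s.1.1.nv s.1.1) s.2).mono hKX))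

/-- `augOut nv` on codes: `(σ, D) ↦ augOut σ.nv σ D`. [folklore] -/
theorem augOut_codeFP : CodeFP (pairE stE gdE) gdE (fun t => SymState.augOut t.1.nv t.1 t.2) := by
  have hσ : CodeFP (pairE stE gdE) stE (fun t => t.1) := fst _ _
  have hu : CodeFP (pairE stE gdE) affE (fun t => AffForm.unit t.1.nv) := by
    exact (affUnit.comp (stNv.comp hσ) :)
  have hf : CodeFP (pairE stE gdE) affE (fun t => (t.1.form 0).addConst true) := by
    exact (affAddConst.comp ((formAt.comp (hσ.pair (const _ (0 : ℕ)))).pair (const _ true)) :)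
  exact ((addQuadProduct_codeFP.comp (hu.pair (hf.pair (snd _ _)))).congr fun t => rfl)

/-- The context of the pair loop: sample context, term number, data. [folklore] -/
abbrev acE : TCtx × ℕ × GData → List Bool := pairE tcE (pairE natE gdE)

/-- **One cut pair step on codes**, in the context `((tc, A, D₀), (p, D))`. [cite: BravyiGosset2016, eq. (17)] -/
theorem pairStepS_codeFP : CodeFP (pairE acE (pairE natE gdE)) gdE
    (fun t => SymState.pairStepS (SymState.numV t.1.1.1.nv t.1.1.1) t.1.1.1.nv t.1.1.1 t.1.2.1 t.2.2 t.2.1) := by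
  have hσ : CodeFP (pairE acE (pairE natE gdE)) stE (fun t => t.1.1.1) := by
    exact ((fst _ _).comp ((fst _ _).comp (fst _ _)) :)
  have hA : CodeFP (pairE acE (pairE natE gdE)) natE (fun t => t.1.2.1) := by
    exact ((snd _ _).fst'.comp (fst _ _) :)
  have hp : CodeFP (pairE acE (pairE natE gdE)) natE (fun t => t.2.1) := (snd _ _).fst'
  have hD : CodeFP (pairE acE (pairE natE gdE)) gdE (fun t => t.2.2) := (snd _ _).snd'
  have hK : CodeFP (pairE acE (pairE natE gdE)) unE (fun t => SymState.numV t.1.1.1.nv t.1.1.1) := by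
    exact (numV_codeFP.comp hσ :)
  have hpu : CodeFP (pairE acE (pairE natE gdE)) unE (fun t => min t.2.1 (SymState.numV t.1.1.1.nv t.1.1.1)) := by
    exact (unOfNatMin.comp (hK.pair hp) :)
  have hpn : CodeFP (pairE acE (pairE natE gdE)) natE (fun t => min t.2.1 (SymState.numV t.1.1.1.nv t.1.1.1)) := by
    exact (natOfUn.comp hpu :)
  have hbit : CodeFP (pairE acE (pairE natE gdE)) bitE
      (fun t => Nat.testBit t.1.2.1 (min (SymState.numV t.1.1.1.nv t.1.1.1) (min t.2.1 (SymState.numV t.1.1.1.nv t.1.1.1)))) := by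
    exact (testBitMin.comp (hK.pair (hA.pair hpn)) :)
  have hu : CodeFP (pairE acE (pairE natE gdE)) affE (fun t => AffForm.unit (t.1.1.1.nv + 1 + min t.2.1 (SymState.numV t.1.1.1.nv t.1.1.1))) := by
    exact (affUnit.comp (unAdd.comp ((unSucc.comp (stNv.comp hσ)).pair hpu)) :)
  have ht0 : CodeFP (pairE acE (pairE natE gdE)) affE (fun t => t.1.1.1.tform (2 * min t.2.1 (SymState.numV t.1.1.1.nv t.1.1.1))) := by
    exact (tformAt.comp (hσ.pair (natMul.comp ((const _ 2).pair hpn))) :)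
  have ht1 : CodeFP (pairE acE (pairE natE gdE)) affE (fun t => t.1.1.1.tform (2 * min t.2.1 (SymState.numV t.1.1.1.nv t.1.1.1) + 1)) := by
    exact (tformAt.comp (hσ.pair (natAdd.comp ((natMul.comp ((const _ 2).pair hpn)).pair (const _ 1)))) :)
  have hform : CodeFP (pairE acE (pairE natE gdE)) affE (fun t =>
      ((t.1.1.1.tform (2 * min t.2.1 (SymState.numV t.1.1.1.nv t.1.1.1))).add
        (t.1.1.1.tform (2 * min t.2.1 (SymState.numV t.1.1.1.nv t.1.1.1) + 1))).addConst
        (Nat.testBit t.1.2.1 (min (SymState.numV t.1.1.1.nv t.1.1.1) (min t.2.1 (SymState.numV t.1.1.1.nv t.1.1.1))))) := by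
    exact (affAddConst.comp ((affAdd.comp (ht0.pair ht1)).pair hbit) :)
  have hD1 : CodeFP (pairE acE (pairE natE gdE)) gdE (fun t =>
      GData.addQuadProduct (AffForm.unit (t.1.1.1.nv + 1 + min t.2.1 (SymState.numV t.1.1.1.nv t.1.1.1)))
        (((t.1.1.1.tform (2 * min t.2.1 (SymState.numV t.1.1.1.nv t.1.1.1))).add
          (t.1.1.1.tform (2 * min t.2.1 (SymState.numV t.1.1.1.nv t.1.1.1) + 1))).addConst
          (Nat.testBit t.1.2.1 (min (SymState.numV t.1.1.1.nv t.1.1.1) (min t.2.1 (SymState.numV t.1.1.1.nv t.1.1.1)))))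
        t.2.2) := by
    exact (addQuadProduct_codeFP.comp (hu.pair (hform.pair hD)) :)
  have hD2 : CodeFP (pairE acE (pairE natE gdE)) gdE (fun t =>
      GData.addPhaseForm 1 (t.1.1.1.tform (2 * min t.2.1 (SymState.numV t.1.1.1.nv t.1.1.1)))
      (GData.addQuadProduct (AffForm.unit (t.1.1.1.nv + 1 + min t.2.1 (SymState.numV t.1.1.1.nv t.1.1.1)))
        (((t.1.1.1.tform (2 * min t.2.1 (SymState.numV t.1.1.1.nv t.1.1.1))).add
          (t.1.1.1.tform (2 * min t.2.1 (SymState.numV t.1.1.1.nv t.1.1.1) + 1))).addConst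
          (Nat.testBit t.1.2.1 (min (SymState.numV t.1.1.1.nv t.1.1.1) (min t.2.1 (SymState.numV t.1.1.1.nv t.1.1.1)))))
        t.2.2)) := by
    exact (addPhaseForm_codeFP.comp ((const _ (1 : ℕ)).pair (ht0.pair hD1)) :)
  refine ((hbit.ite hD1 hD2).congr fun t => ?_)
  unfold SymState.pairStepS SymState.pairStep
  simp only
  rw [min_comm t.2.1, min_eq_right (min_le_left _ _)]

/-- **The pair loop on codes**, from the context `(tc, A, D)`. [cite: AroraBarakCC2009, §1.3] -/
theorem augAS_codeFP : CodeFP acE gdE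
    (fun s => SymState.augAS (SymState.numV s.1.1.nv s.1.1) s.1.1.nv s.1.1 s.2.1 s.2.2) := by
  have hσ : CodeFP acE stE (fun s => s.1.1) := by
    exact ((fst _ _).comp (fst _ _) :)
  have hK : CodeFP acE unE (fun s => SymState.numV s.1.1.nv s.1.1) := by
    exact (numV_codeFP.comp hσ :)
  have hinit : CodeFP acE gdE (fun s => GData.sanitize (SymState.numV s.1.1.nv s.1.1) s.2.2) := by
    exact (sanitize_codeFP.comp (hK.pair ((snd _ _).snd')) :)
  have hlist : CodeFP acE (rawE natE) (fun s => List.range (SymState.numA s.1.1)) := by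
    exact (urange.comp (numA_codeFP.comp hσ) :)
  have h := foldl (σ := TCtx × ℕ × GData) (α := ℕ) (β := GData) (eσ := acE) (eα := natE) (eβ := gdE)
    (step := fun s p D => SymState.pairStepS (SymState.numV s.1.1.nv s.1.1) s.1.1.nv s.1.1 s.2.1 D p)
    (init := fun s => GData.sanitize (SymState.numV s.1.1.nv s.1.1) s.2.2) pairStepS_codeFP hinit
    (8 * (2 * Polynomial.X + 2) ^ 2 + 18 * (2 * Polynomial.X + 2) + 10) (fun s l₁ l₂ => ?_)
  · exact ((h.comp ((CodeFP.id acE).pair hlist)).congr fun s => rfl)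
  · have hev : (8 * (2 * Polynomial.X + 2) ^ 2 + 18 * (2 * Polynomial.X + 2) + 10 : Polynomial ℕ).eval
        (pairE acE (rawE natE) (s, l₁ ++ l₂)).length =
        8 * (2 * (pairE acE (rawE natE) (s, l₁ ++ l₂)).length + 2) ^ 2 +
          18 * (2 * (pairE acE (rawE natE) (s, l₁ ++ l₂)).length + 2) + 10 := by
      simp [Polynomial.eval_add, Polynomial.eval_mul, Polynomial.eval_pow]
    rw [hev]
    set X := (pairE acE (rawE natE) (s, l₁ ++ l₂)).length with hX
    have hσX : (stE s.1.1).length + 1 ≤ X := by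
      rw [hX]
      show _ ≤ (boolPair (boolPair (boolPair (stE s.1.1) (boolPair (unE s.1.2.1) (bitsE s.1.2.2)))
        (boolPair (natE s.2.1) (gdE s.2.2))) (rawE natE (l₁ ++ l₂))).length
      rw [length_boolPair, length_boolPair, length_boolPair]; omega
    have hT : ∀ k, (s.1.1.tform k).a.length ≤ 2 * X + 2 := fun k => (length_tform_le_stE _ k).trans (by omega)
    have hKX : SymState.numV s.1.1.nv s.1.1 ≤ X := (numV_le_stE _).trans hσX
    have hnv : s.1.1.nv ≤ X := by
      have : (unE s.1.1.nv).length ≤ (stE s.1.1).length := by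
        show (unE s.1.1.nv).length ≤
          (boolPair (rawE affE s.1.1.forms) (boolPair (gdE s.1.1.D) (boolPair (rawE affE s.1.1.tforms) (unE s.1.1.nv)))).length
        rw [length_boolPair, length_boolPair, length_boolPair]; omega
      rw [length_unE] at this; omega
    exact GData.length_gdE_le (SymState.sized_foldl_pairStepS (B := 2 * X + 2) hT s.2.1 (by omega) l₁
      ((GData.sized_sanitize (SymState.numV s.1.1.nv s.1.1) s.2.2).mono (by omega)))

/-- **The Gauss data of a term on codes**: `((σ, 1ᴺ, block), A) ↦ buildDataS (numV) N nv β A σ`.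
[cite: BravyiGosset2016, §II eq. (12)–(13) and eq. (17)] -/
theorem buildDataS_codeFP : CodeFP (pairE tcE natE) gdE
    (fun s => SymState.buildDataS (SymState.numV s.1.1.nv s.1.1) s.1.2.1 s.1.1.nv (fun p => s.1.2.2.getD p false) s.2 s.1.1) := by
  have htc : CodeFP (pairE tcE natE) tcE (fun s => s.1) := fst _ _
  have hσ : CodeFP (pairE tcE natE) stE (fun s => s.1.1) := by
    exact ((fst _ _).comp htc :)
  have h1 : CodeFP (pairE tcE natE) gdE (fun s =>
      SymState.augRS (SymState.numV s.1.1.nv s.1.1) s.1.2.1 (fun p => s.1.2.2.getD p false) s.1.1 s.1.1.D) := by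
    exact (augRS_codeFP.comp htc :)
  have h2 : CodeFP (pairE tcE natE) gdE (fun s =>
      SymState.augRhoS (SymState.numV s.1.1.nv s.1.1) s.1.2.1 (fun p => s.1.2.2.getD p false) s.1.1
        (SymState.augRS (SymState.numV s.1.1.nv s.1.1) s.1.2.1 (fun p => s.1.2.2.getD p false) s.1.1 s.1.1.D)) := by
    exact (augRhoS_codeFP.comp (htc.pair h1) :)
  have h3 : CodeFP (pairE tcE natE) gdE (fun s => SymState.augOut s.1.1.nv s.1.1
      (SymState.augRhoS (SymState.numV s.1.1.nv s.1.1) s.1.2.1 (fun p => s.1.2.2.getD p false) s.1.1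
        (SymState.augRS (SymState.numV s.1.1.nv s.1.1) s.1.2.1 (fun p => s.1.2.2.getD p false) s.1.1 s.1.1.D))) := by
    exact (augOut_codeFP.comp (hσ.pair h2) :)
  exact ((augAS_codeFP.comp (htc.pair ((snd _ _).pair h3))).congr fun s => rfl)

/-- The cut digit count on codes: `(σ, A) ↦ popNS (numV) (numA) A`. [folklore] -/
theorem popNS_codeFP : CodeFP (pairE stE natE) natE
    (fun s => popNS (SymState.numV s.1.nv s.1) (SymState.numA s.1) s.2) := by
  have hstep : CodeFP (pairE (pairE stE natE) (pairE natE natE)) natE (fun t =>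
      t.2.2 + Bool.toNat (Nat.testBit t.1.2 (min (SymState.numV t.1.1.nv t.1.1) t.2.1))) := by
    exact (natAdd.comp (((snd _ _).snd').pair (toNat_codeFP.comp (testBitMin.comp ((numV_codeFP.comp ((fst _ _).comp (fst _ _))).pair (((fst _ _).snd').pair ((snd _ _).fst')))))) :)
  have hlist : CodeFP (pairE stE natE) (rawE natE) (fun s => List.range (SymState.numA s.1)) := by
    exact (urange.comp (numA_codeFP.comp (fst _ _)) :)
  have h := foldl (σ := SymState × ℕ) (α := ℕ) (β := ℕ) (eσ := pairE stE natE) (eα := natE) (eβ := natE)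
    (step := fun s p acc => acc + Bool.toNat (Nat.testBit s.2 (min (SymState.numV s.1.nv s.1) p)))
    (init := fun _ => 0) hstep (const _ (0 : ℕ)) Polynomial.X (fun s l₁ l₂ => ?_)
  · exact ((h.comp ((CodeFP.id _).pair hlist)).congr fun s => rfl)
  · rw [Polynomial.eval_X]
    have hb : ∀ (l : List ℕ) (acc : ℕ),
        l.foldl (fun acc p => acc + Bool.toNat (Nat.testBit s.2 (min (SymState.numV s.1.nv s.1) p))) acc ≤ acc + l.length := by
      intro l
      induction l with
      | nil => intro acc; simp
      | cons p l ih =>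
        intro acc
        rw [List.foldl_cons, List.length_cons]
        refine (ih _).trans ?_
        have : Bool.toNat (Nat.testBit s.2 (min (SymState.numV s.1.nv s.1) p)) ≤ 1 := Bool.toNat_le _
        omega
    refine ((length_natE_le _).trans ((hb l₁ 0).trans ?_))
    rw [Nat.zero_add]
    have := length_le_length_rawE natE (l₁ ++ l₂)
    rw [List.length_append] at this
    show l₁.length ≤ (boolPair _ (rawE natE (l₁ ++ l₂))).length
    rw [length_boolPair]; omega

/-- The code of the pair of accumulators. [folklore] -/
abbrev eoE : (ℤ × ℤ) × (ℤ × ℤ) → List Bool := pairE zgE zgE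

/-- **One term step on codes**: `((σ, 1ᴺ, block), ((E, O), A)) ↦ termStepS N β σ (E, O) A`.
[cite: BravyiGosset2016, §II eq. (12)–(13)] -/
theorem termStepS_codeFP : CodeFP (pairE tcE (pairE eoE natE)) eoE
    (fun s => termStepS s.1.2.1 (fun p => s.1.2.2.getD p false) s.1.1 s.2.1 s.2.2) := by
  have htc : CodeFP (pairE tcE (pairE eoE natE)) tcE (fun s => s.1) := fst _ _
  have hσ : CodeFP (pairE tcE (pairE eoE natE)) stE (fun s => s.1.1) := by
    exact ((fst _ _).comp htc :)
  have hA : CodeFP (pairE tcE (pairE eoE natE)) natE (fun s => s.2.2) := (snd _ _).snd'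
  have hE : CodeFP (pairE tcE (pairE eoE natE)) zgE (fun s => s.2.1.1) := (snd _ _).fst'.fst'
  have hO : CodeFP (pairE tcE (pairE eoE natE)) zgE (fun s => s.2.1.2) := (snd _ _).fst'.snd'
  have hK : CodeFP (pairE tcE (pairE eoE natE)) unE (fun s => SymState.numV s.1.1.nv s.1.1) := by
    exact (numV_codeFP.comp hσ :)
  have hm : CodeFP (pairE tcE (pairE eoE natE)) natE
      (fun s => popNS (SymState.numV s.1.1.nv s.1.1) (SymState.numA s.1.1) s.2.2) := by
    exact (popNS_codeFP.comp (hσ.pair hA) :)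
  have hD : CodeFP (pairE tcE (pairE eoE natE)) gdE (fun s =>
      SymState.buildDataS (SymState.numV s.1.1.nv s.1.1) s.1.2.1 s.1.1.nv (fun p => s.1.2.2.getD p false) s.2.2 s.1.1) := by
    exact (buildDataS_codeFP.comp (htc.pair hA) :)
  have hg : CodeFP (pairE tcE (pairE eoE natE)) zgE (fun s =>
      zgOf (GData.gaussEval (SymState.numV s.1.1.nv s.1.1) (GData.sanitize (SymState.numV s.1.1.nv s.1.1)
        (SymState.buildDataS (SymState.numV s.1.1.nv s.1.1) s.1.2.1 s.1.1.nv (fun p => s.1.2.2.getD p false) s.2.2 s.1.1)))) := by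
    exact (gaussEval_codeFP.comp (hK.pair hD) :)
  have hc : CodeFP (pairE tcE (pairE eoE natE)) zgE (fun s =>
      zgMul (iPowZg (popNS (SymState.numV s.1.1.nv s.1.1) (SymState.numA s.1.1) s.2.2 / 2))
      (zgOf (GData.gaussEval (SymState.numV s.1.1.nv s.1.1) (GData.sanitize (SymState.numV s.1.1.nv s.1.1)
        (SymState.buildDataS (SymState.numV s.1.1.nv s.1.1) s.1.2.1 s.1.1.nv (fun p => s.1.2.2.getD p false) s.2.2 s.1.1))))) := by
    exact (zgMul_codeFP.comp ((iPowZg_codeFP.comp (natDiv.comp (hm.pair (const _ 2)))).pair hg) :)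
  have hpar : CodeFP (pairE tcE (pairE eoE natE)) bitE
      (fun s => decide (popNS (SymState.numV s.1.1.nv s.1.1) (SymState.numA s.1.1) s.2.2 % 2 = 0)) := by
    exact (natEq.comp ((natMod.comp (hm.pair (const _ 2))).pair (const _ 0)) :)
  have hev : CodeFP (pairE tcE (pairE eoE natE)) eoE (fun s =>
      (zgAdd s.2.1.1 (zgMul (iPowZg (popNS (SymState.numV s.1.1.nv s.1.1) (SymState.numA s.1.1) s.2.2 / 2))
      (zgOf (GData.gaussEval (SymState.numV s.1.1.nv s.1.1) (GData.sanitize (SymState.numV s.1.1.nv s.1.1)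
        (SymState.buildDataS (SymState.numV s.1.1.nv s.1.1) s.1.2.1 s.1.1.nv (fun p => s.1.2.2.getD p false) s.2.2 s.1.1))))), s.2.1.2)) := by
    exact ((zgAdd_codeFP.comp (hE.pair hc)).pair hO :)
  have hod : CodeFP (pairE tcE (pairE eoE natE)) eoE (fun s =>
      (s.2.1.1, zgAdd s.2.1.2 (zgMul (iPowZg (popNS (SymState.numV s.1.1.nv s.1.1) (SymState.numA s.1.1) s.2.2 / 2))
      (zgOf (GData.gaussEval (SymState.numV s.1.1.nv s.1.1) (GData.sanitize (SymState.numV s.1.1.nv s.1.1)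
        (SymState.buildDataS (SymState.numV s.1.1.nv s.1.1) s.1.2.1 s.1.1.nv (fun p => s.1.2.2.getD p false) s.2.2 s.1.1))))))) := by
    exact (hE.pair (zgAdd_codeFP.comp (hO.pair hc)) :)
  refine ((hpar.ite hev hod).congr fun s => ?_)
  unfold termStepS
  simp only [decide_eq_true_eq]


end Literature.Computability.QuantumComplexity.BravyiGosset
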